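import Summits.KontsevichZagierPeriods.KontsevichZagierPeriods.Theorems.MultiplicationAccessible.Negative.Core

/-!
# Crux `MultiplicationAccessible` (stmt-KontsevichZagierPeriods-12305) — negative knowledge, part 2: first-rung calibration and refuted variants

Landed copy of §§5–6 of `Cruxes/MultiplicationAccessible/Disproof.lean` (crux disprover, gen 1).
Explicit representations at `(m, s) = (1, 1)`: `boxRepOneOne = [(0,1), x^{−1/2}]`,
`simplexRepOneOne = [(0,2), 1]`, both of value `2` (`values_agree_one_one`: no evaluation kill at
the first rung), and two refutations:

* `not_unitSimplexVariant` — the simplex side normalised to the UNIT simplex (`Σσ < 1`, Dirichlet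
  form) is FALSE (`2 ≠ 1` by `KZ.eval`): the scaling `Σσ < m+1` of the crux is tight.
* `not_byAdditivity` — the pair is NOT connected by the additivity moves (1a)+(1b) alone
  (`KZ.restrictedEval` over the box window, `2 ≠ 1`): every derivation uses a change of variables
  or a Newton–Leibniz move.
(Part 3, `OneMove.lean`: conversely the `(1, 1)` pair IS one rule-(2) move `σ = 2√x`.)

Reference: M. Kontsevich, D. Zagier, *Periods* (2001), §1.2.
-/

noncomputable section

open MeasureTheory Set
open Literature.NumberTheory.Transcendental
open Literature.NumberTheory.Transcendental.KZ
open Summit.KontsevichZagierPeriods.KontsevichZagierPeriods.Theses.TerasomaMultiplication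
  (MultiplicationAccessible)

namespace Summit.KontsevichZagierPeriods.MultiplicationAccessible.Negative

variable {m n : ℕ} {s : ℚ}

/-! ## §5 Dimension-1 calibration (`m = 1`, duplication): infrastructure and values -/

section DimOne

open Literature.ModelTheory.ExponentialFields (IsSemialgebraic)
open MvPolynomial (X C aeval)

/-- The ray-simplex domain `{x | (∀ i, 0 < x i) ∧ ∑ x i < c}` in dimension `1`. [folklore] -/
def raySimplexDom (c : ℝ) : Set (Fin 1 → ℝ) := {x | (∀ i, 0 < x i) ∧ ∑ i, x i < c}

/-- In dimension `1` the ray simplex is the preimage of `(0, c)`. [folklore] -/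
theorem raySimplexDom_eq (c : ℝ) :
    raySimplexDom c = MeasurableEquiv.funUnique (Fin 1) ℝ ⁻¹' Ioo 0 c := by
  ext x
  simp [raySimplexDom, MeasurableEquiv.funUnique, Fin.forall_fin_one, Fin.default_eq_zero]

/-- The crux's simplex domain at `m = 1` is the ray simplex `(0, 2)`. [folklore] -/
theorem simplexDom_one : simplexDom 1 = raySimplexDom 2 := by
  ext x
  simp only [simplexDom, raySimplexDom, Nat.cast_one, mem_setOf_eq]
  norm_num

/-- The ray simplex with rational end is `ℚ`-semialgebraic. [folklore] -/
theorem isSemialgebraic_raySimplexDom (c : ℚ) : IsSemialgebraic ℚ (raySimplexDom (c : ℝ)) := by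
  have h1 := Literature.ModelTheory.ExponentialFields.isSemialgebraic_setOf_eval_pos (k := ℚ)
    (R := ℝ) (X 0 : MvPolynomial (Fin 1) ℚ)
  have h2 := Literature.ModelTheory.ExponentialFields.isSemialgebraic_setOf_eval_lt (k := ℚ)
    (R := ℝ) (X 0 : MvPolynomial (Fin 1) ℚ) (C c : MvPolynomial (Fin 1) ℚ)
  simp only [MvPolynomial.aeval_X, MvPolynomial.aeval_C, eq_ratCast] at h1 h2
  convert h1.inter h2 using 1
  ext x
  simp [raySimplexDom, Fin.forall_fin_one]

/-- **Dimension-1 representation from a function of one real variable** on a domain `D ⊆ ℝ¹` which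
is the preimage of `I ⊆ ℝ` under `x ↦ x 0`: integrability is transported along the
measure-preserving `funUnique`. [folklore] -/
def dimOneRep (D : Set (Fin 1 → ℝ)) (I : Set ℝ) (hD : D = MeasurableEquiv.funUnique (Fin 1) ℝ ⁻¹' I)
    (hDs : IsSemialgebraic ℚ D) (h : ℝ → ℝ) (hh : IsSemialgebraicFunOn ℚ D fun x => h (x 0))
    (hint : IntegrableOn h I) : IntegralRep 1 where
  domain := D
  integrand x := h (x 0)
  isSemialgebraic_domain := hDs
  isSemialgebraicFunOn_integrand := hh
  integrableOn := by
    rw [hD]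
    exact ((volume_preserving_funUnique (Fin 1) ℝ).integrableOn_comp_preimage
      (MeasurableEquiv.measurableEmbedding _)).mpr hint

/-- The value of a dimension-1 representation is the one-variable integral. [folklore] -/
theorem dimOneRep_value (D : Set (Fin 1 → ℝ)) (I : Set ℝ)
    (hD : D = MeasurableEquiv.funUnique (Fin 1) ℝ ⁻¹' I) (hDs : IsSemialgebraic ℚ D) (h : ℝ → ℝ)
    (hh : IsSemialgebraicFunOn ℚ D fun x => h (x 0)) (hint : IntegrableOn h I) :
    (dimOneRep D I hD hDs h hh hint).value = ∫ t in I, h t := by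
  change ∫ x in D, h (x 0) = _
  rw [hD, ← (volume_preserving_funUnique (Fin 1) ℝ).setIntegral_preimage_emb
    (MeasurableEquiv.measurableEmbedding _) h I]
  rfl

/-- A set integral over `D` of a function of `x 0`, transported to `ℝ`. [folklore] -/
theorem setIntegral_dimOne (D : Set (Fin 1 → ℝ)) (I : Set ℝ)
    (hD : D = MeasurableEquiv.funUnique (Fin 1) ℝ ⁻¹' I) (h : ℝ → ℝ) :
    ∫ x in D, h (x 0) = ∫ t in I, h t := by
  rw [hD, ← (volume_preserving_funUnique (Fin 1) ℝ).setIntegral_preimage_emb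
    (MeasurableEquiv.measurableEmbedding _) h I]
  rfl

/-- `x ↦ (x 0)^a` with rational `a` is `ℚ`-semialgebraic on every `ℚ`-semialgebraic set of positive
points (tree: `KZ.isSemialgebraicFunOn_mellinIntegrand` with the one-member family `X 0`).
[folklore] -/
theorem isSemialgebraicFunOn_rpow_coord {D : Set (Fin 1 → ℝ)} (hDs : IsSemialgebraic ℚ D)
    (hpos : ∀ x ∈ D, 0 < x 0) (a : ℚ) :
    IsSemialgebraicFunOn ℚ D fun x => (x 0) ^ (a : ℝ) := by
  have h := isSemialgebraicFunOn_mellinIntegrand hDs (fun _ : Fin 1 => (X 0 : MvPolynomial (Fin 1) ℚ))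
    (fun _ => a) 1 (fun x hx _ => by simpa using hpos x hx)
  refine h.congr fun x _ => ?_
  simp [mellinIntegrand]

/-- Constants are `ℚ`-semialgebraic functions (as functions of `x 0`). [folklore] -/
theorem isSemialgebraicFunOn_const_coord {D : Set (Fin 1 → ℝ)} (hDs : IsSemialgebraic ℚ D) (q : ℚ) :
    IsSemialgebraicFunOn ℚ D fun x => (fun _ : ℝ => (q : ℝ)) (x 0) :=
  (isSemialgebraicFunOn_aeval hDs (C q : MvPolynomial (Fin 1) ℚ)).congr fun x _ => by
    simp [eq_ratCast]

/-- `∫₀¹ t^a dt = 1/(a+1)` for `a > −1`. [folklore] -/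
theorem setIntegral_rpow_Ioo_zero_one {a : ℝ} (ha : -1 < a) :
    ∫ t in Ioo (0:ℝ) 1, t ^ a = 1 / (a + 1) := by
  rw [← integral_Ioc_eq_integral_Ioo, ← intervalIntegral.integral_of_le zero_le_one,
    integral_rpow (Or.inl ha)]
  have : a + 1 ≠ 0 := by linarith
  simp [Real.zero_rpow this]

/-- `t ↦ t^a` is integrable on `(0,1)` for `a > −1`. [folklore] -/
theorem integrableOn_rpow_Ioo_zero_one {a : ℝ} (ha : -1 < a) :
    IntegrableOn (fun t : ℝ => t ^ a) (Ioo (0:ℝ) 1) :=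
  (intervalIntegral.integrableOn_Ioo_rpow_iff zero_lt_one).mpr ha

/-- **The box representation at `(m, s) = (1, 1)`**: `[(0,1), x^(−1/2)]`. [folklore] -/
def boxRepOneOne : IntegralRep 1 :=
  dimOneRep (boxDom 1) (Ioo 0 1) boxDom_one_eq (isSemialgebraic_boxDom 1)
    (fun t => t ^ (((-1)/2 : ℚ) : ℝ))
    (isSemialgebraicFunOn_rpow_coord (isSemialgebraic_boxDom 1) (fun x hx => (hx 0).1) _)
    (by
      have : (((-1)/2 : ℚ) : ℝ) = -1/2 := by push_cast; ring
      rw [this]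
      exact integrableOn_rpow_Ioo_zero_one (by norm_num))

/-- `boxRepOneOne` is a box representation of the crux at `(1, 1)`. [folklore] -/
theorem isBoxRep_boxRepOneOne : IsBoxRep 1 1 boxRepOneOne := by
  refine ⟨rfl, fun x hx => ?_⟩
  have hx0 : 0 < x 0 ∧ x 0 < 1 := hx 0
  simp only [boxRepOneOne, dimOneRep, boxFun, Fin.prod_univ_one, Fin.val_zero, Nat.cast_zero,
    Nat.cast_one, Rat.cast_one, sub_self, Real.rpow_zero, mul_one]
  norm_num

/-- The value of `boxRepOneOne` is `2` (`= B(1/2, 1)`). [folklore] -/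
theorem boxRepOneOne_value : boxRepOneOne.value = 2 := by
  rw [boxRepOneOne, dimOneRep_value]
  have : (((-1)/2 : ℚ) : ℝ) = -1/2 := by push_cast; ring
  rw [this, setIntegral_rpow_Ioo_zero_one (by norm_num)]
  norm_num

/-- **The simplex representation at `(m, s) = (1, 1)`**: `[(0,2), 1]`. [folklore] -/
def simplexRepOneOne : IntegralRep 1 :=
  dimOneRep (simplexDom 1) (Ioo 0 2) (by rw [simplexDom_one, raySimplexDom_eq])
    (by rw [simplexDom_one]; exact_mod_cast isSemialgebraic_raySimplexDom 2)
    (fun _ => ((1 : ℚ) : ℝ))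
    (isSemialgebraicFunOn_const_coord
      (by rw [simplexDom_one]; exact_mod_cast isSemialgebraic_raySimplexDom 2) 1)
    (integrableOn_const (by simp))

/-- `simplexRepOneOne` is a simplex representation of the crux at `(1, 1)`. [folklore] -/
theorem isSimplexRep_simplexRepOneOne : IsSimplexRep 1 1 simplexRepOneOne := by
  refine ⟨rfl, fun x _ => ?_⟩
  simp [simplexRepOneOne, dimOneRep, simplexFun]

/-- The value of `simplexRepOneOne` is `2` (the length of `(0, 2)`). [folklore] -/
theorem simplexRepOneOne_value : simplexRepOneOne.value = 2 := by
  rw [simplexRepOneOne, dimOneRep_value]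
  simp

/-- **No evaluation kill at `(1, 1)`**: both values are `2` (consistency of the crux with
soundness at the first rung; the general identity is Gauss multiplication, `ValueIdentity`). [folklore] -/
theorem values_agree_one_one : boxRepOneOne.value = simplexRepOneOne.value := by
  rw [boxRepOneOne_value, simplexRepOneOne_value]

end DimOne

/-! ## §6 Refuted variants and strengthenings -/

section Variants

open Literature.ModelTheory.ExponentialFields (IsSemialgebraic)

/-- VARIANT (tightness of the normalisation): the simplex side normalised to the UNIT simplex
`{σ > 0, Σσ < 1}` with integrand `(∏σ · (1 − Σσ))^(s−1)` (the Dirichlet form, value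
`Γ(s)^n/Γ(ns)` — the factor `n^{ns−1}` dropped); refuted below. -/
def UnitSimplexVariant : Prop :=
  ∀ (m : ℕ) (s : ℚ), 1 ≤ m → 0 < s → ∀ (r r' : IntegralRep m),
    r.domain = {x | ∀ i, x i ∈ Set.Ioo (0:ℝ) 1} → Set.EqOn r.integrand (boxFun m s) r.domain →
    r'.domain = {x | (∀ i, 0 < x i) ∧ ∑ i, x i < 1} →
    Set.EqOn r'.integrand (fun x => ((∏ i, x i) * (1 - ∑ i, x i)) ^ ((s:ℝ) - 1)) r'.domain →
    Equivalent r r'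

/-- The unit-simplex representation at `(1, 1)`: `[(0,1), 1]`, value `1`. [folklore] -/
def unitSimplexRepOneOne : IntegralRep 1 :=
  dimOneRep (raySimplexDom 1) (Ioo 0 1) (raySimplexDom_eq 1)
    (by exact_mod_cast isSemialgebraic_raySimplexDom 1) (fun _ => ((1 : ℚ) : ℝ))
    (isSemialgebraicFunOn_const_coord (by exact_mod_cast isSemialgebraic_raySimplexDom 1) 1)
    (integrableOn_const (by simp))

/-- The value of `unitSimplexRepOneOne` is `1`. [folklore] -/
theorem unitSimplexRepOneOne_value : unitSimplexRepOneOne.value = 1 := by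
  rw [unitSimplexRepOneOne, dimOneRep_value]
  simp

/-- **The unit-simplex normalisation is FALSE** (witness `(m, s) = (1, 1)`: box value `2`, unit
simplex value `1`, separated by `KZ.eval`): the scaling `Σσ < n` of the crux is forced; any proof
must carry the constant `n^{ns−1}` through the chain (one scaling move `σ = nτ`, |det| = n^m, plus
the rational power `n^{n(s−1)}` absorbed into the integrand). [folklore] -/
theorem not_unitSimplexVariant : ¬ UnitSimplexVariant := by
  intro h
  have hEq : Equivalent boxRepOneOne unitSimplexRepOneOne := by
    refine h 1 1 le_rfl one_pos boxRepOneOne unitSimplexRepOneOne isBoxRep_boxRepOneOne.1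
      isBoxRep_boxRepOneOne.2 ?_ ?_
    · change raySimplexDom 1 = _
      ext x
      simp [raySimplexDom]
    · intro x _
      simp [unitSimplexRepOneOne, dimOneRep]
  have hv := Equivalent.value_eq_holds hEq
  rw [boxRepOneOne_value, unitSimplexRepOneOne_value] at hv
  norm_num at hv

/-- STRENGTHENING (sub-calculus): box ~ simplex by the ADDITIVITY moves (1a) + (1b) alone;
refuted below. -/
def ByAdditivity : Prop :=
  ∀ (m : ℕ) (s : ℚ), 1 ≤ m → 0 < s → ∀ r r' : IntegralRep m, IsBoxRep m s r → IsSimplexRep m s r' →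
    of r - of r' ∈ AddSubgroup.closure (domainAddRel ∪ integrandAddRel)

/-- Restricted evaluation over the box window: the box representation at `(1,1)` keeps its full
value `2`. [folklore] -/
theorem restrictedEval_boxRepOneOne : restrictedEval boxDom (of boxRepOneOne) = 2 := by
  rw [restrictedEval_of, ← boxRepOneOne_value]
  change ∫ x in boxDom 1 ∩ boxDom 1, _ = _
  rw [Set.inter_self]
  rfl

/-- Restricted evaluation over the box window: the simplex representation at `(1,1)` restricted
to `(0,1)` has value `1`. [folklore] -/
theorem restrictedEval_simplexRepOneOne : restrictedEval boxDom (of simplexRepOneOne) = 1 := by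
  rw [restrictedEval_of]
  change ∫ x in simplexDom 1 ∩ boxDom 1, (fun _ : ℝ => ((1 : ℚ) : ℝ)) (x 0) = 1
  have hsub : simplexDom 1 ∩ boxDom 1 = boxDom 1 := by
    rw [Set.inter_eq_right]
    intro x hx
    refine ⟨fun i => (hx i).1, ?_⟩
    simp only [Fin.sum_univ_one, Nat.cast_one]
    linarith [(hx 0).2]
  rw [hsub, setIntegral_dimOne (boxDom 1) (Ioo 0 1) boxDom_one_eq (fun _ => ((1 : ℚ) : ℝ))]
  simp

/-- **Additivity alone is FALSE** (witness `(1, 1)`, separated by the tree's invariant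
`KZ.restrictedEval` over the box window, `2 ≠ 1`): the box and the simplex representation are not
scissors-congruent in situ — **every derivation uses a change of variables or a Newton–Leibniz
move**. [folklore] -/
theorem not_byAdditivity : ¬ ByAdditivity := by
  intro h
  have hmem := h 1 1 le_rfl one_pos boxRepOneOne simplexRepOneOne isBoxRep_boxRepOneOne
    isSimplexRep_simplexRepOneOne
  have hker := closure_add_le_ker_restrictedEval boxDom measurableSet_boxDom hmem
  rw [AddMonoidHom.mem_ker, map_sub, restrictedEval_boxRepOneOne, restrictedEval_simplexRepOneOne]
    at hker
  norm_num at hker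

end Variants


end Summit.KontsevichZagierPeriods.MultiplicationAccessible.Negative
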